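import Summits.CriticalPhenomena.PercolationContinuityZ3.Theorems.PercNonProliferationMeanCauchySchwarz
import Literature.Probability.Percolation.SharpnessDCTProofs
import HarnessLib

/-!
# Crux `PercNonProliferation.FreeBoxPowerSaving` (stmt-CriticalPhenomena-4447), line `Sketch_r2_ideator4` (card `onearm-currency-arm-cauchy-schwarz`) — stub `stub_armCauchySchwarz`

Helper file for the crux skeleton `Cruxes/FreeBoxPowerSaving/Lines/Sketch_r2_ideator4.lean`
(lead prover-line-stmt-CriticalPhenomena-4447-a2-0). Proves exactly the registered stub signature
`stub_armCauchySchwarz` (the arm-mass Cauchy–Schwarz inequality of the line's dictionary); lands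
with `--supports stmt-CriticalPhenomena-4447`.

## The statement

Bond percolation `P_p` on `ℤ³`, `B(n) = box 3 n`, `Λ = box 3 (2n)`. For every `p` and `n`,

  `A_p(n)² ≤ E_p[N_n] · E_p[S_n]`,

where `A_p(n) = ∑_{x ∈ B(n)} P_p(x ↔ ∂⁻Λ inside Λ)` is the expected number of ARMED points of
`B(n)`, `E_p[N_n] = ∑_{k < |B(n)|} P_p(∃ k+1 points of B(n), pairwise not joined inside Λ, each
joined inside Λ to ∂⁻Λ)` (the mean number of clusters of the open graph induced on `Λ` meeting both
`B(n)` and `∂⁻Λ`, as a layer-cake sum) and `E_p[S_n] = ∑_{x,y ∈ B(n)} P_p(x ↔ y inside Λ)`.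

## The argument

This is the landed `meanCauchySchwarz_proof` (`PercNonProliferationMeanCauchySchwarz.lean`,
item stmt-CriticalPhenomena-4450) with the percolating points replaced by the armed points.

* Pointwise, for EVERY configuration `ω` (`ArmCauchySchwarz.card_sq_le`): let
  `P = {x ∈ B(n) : x ↔ ∂⁻Λ inside Λ}` and `x ~ y` iff `x ↔ y` inside `Λ`, an equivalence relation on
  `P ⊆ B(n) ⊆ Λ`. `MeanCauchySchwarz.card_sq_le_card_image_mul_sum` gives
  `|P|² ≤ m · ∑_{x ∈ P} #{z ∈ P : x ~ z}` with `m` the number of classes, and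
  `MeanCauchySchwarz.exists_transversal` gives `m` pairwise-unrelated points of `P`; for `k < m` the
  first `k+1` of them witness the `k`-th representative event (each is armed by definition of `P`,
  and `k < m ≤ |P| ≤ |B(n)|`), so `m ≤ N(ω) = #{k < |B(n)| : k-th event holds}`; finally
  `∑_{x ∈ P} #{z ∈ P : x ~ z} ≤ ∑_{x ∈ B(n)} #{y ∈ B(n) : x ~ y} = S(ω)`. Hence `V² ≤ N S` with
  `V = |P|`.
* Integration (`ArmCauchySchwarz.sq_sum_le_of_ae`, the variant of
  `MeanCauchySchwarz.sq_mul_card_le_of_ae` with `∑_{x ∈ B} μ(Pev x)` in place of `θ |B|`, the armed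
  points having different probabilities): the three variables are finite sums of indicators, their
  means are the three sums of the statement (`integral_indicator_one`, `integral_finsetSum`), and
  `MeanCauchySchwarz.sq_integral_le_mul_integral` turns `V² ≤ N S` a.e. into `(E V)² ≤ E N · E S`.
* Measurability: `DCT16.measurableSet_openConnIn`, `MeanCauchySchwarz.measurableSet_spanningFamily`
  and, for the armed event (a finite union of the former), `ArmCauchySchwarz.measurableSet_armed`.

No FKG, no uniqueness, no ergodic theorem, no `ω ⊆ E(ℤ³)` is used.

Tree API: `MeanCauchySchwarz.card_sq_le_card_image_mul_sum`, `MeanCauchySchwarz.exists_transversal`,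
`MeanCauchySchwarz.measurableSet_spanningFamily`, `MeanCauchySchwarz.sq_integral_le_mul_integral`,
`DCT16.measurableSet_openConnIn`, `box_mono`.
Mathlib: `Finset.sum_le_sum`, `Finset.card_le_card`, `Finset.sum_le_sum_of_subset_of_nonneg`,
`integral_indicator_one`, `integral_finsetSum`.
-/

noncomputable section

namespace Summit.CriticalPhenomena.PercolationContinuityZ3.FreeBoxPowerSavingLine

open MeasureTheory ProbabilityTheory
open Literature.Probability.Percolation Literature.Probability.LatticeModels
open Summit.CriticalPhenomena.PercolationContinuityZ3.Theorems
open scoped Classical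

namespace ArmCauchySchwarz

/-! ### The pointwise count `V² ≤ N · S` for the armed points -/

/-- **Pointwise count.** For every configuration `ω` on `ℤ^d` and `n ≤ m`: with
`P = {x ∈ B(n) : x ↔ ∂⁻B(m) inside B(m)}` (the armed points),
`N = #{k < |B(n)| : some k+1 points of B(n) are pairwise not joined inside B(m) and each joined
inside B(m) to ∂⁻B(m)}` and the pair count `S = ∑_{x ∈ B(n)} #{y ∈ B(n) : x ↔ y inside B(m)}`,
one has `|P|² ≤ N · S` (Cauchy–Schwarz over the classes of "joined inside `B(m)`" on `P`, and a
transversal of the classes witnesses the representative events). -/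
theorem card_sq_le (d : ℕ) {n m : ℕ} (hnm : n ≤ m) (ω : BondConfig (Site d)) :
    ((box d n).filter fun x => ∃ y ∈ innerBoundary (zdGraph d) (box d m),
        ω ∈ openConnIn (↑(box d m) : Set (Site d)) x y).card ^ 2 ≤
      ((Finset.range (box d n).card).filter fun k => ∃ x : Fin (k + 1) → Site d,
          (∀ i, x i ∈ box d n) ∧
          (∀ i, ∃ y ∈ innerBoundary (zdGraph d) (box d m),
            ω ∈ openConnIn (↑(box d m) : Set (Site d)) (x i) y) ∧
          ∀ i j, i ≠ j → ω ∉ openConnIn (↑(box d m) : Set (Site d)) (x i) (x j)).card *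
      ∑ x ∈ box d n, ((box d n).filter fun y =>
          ω ∈ openConnIn (↑(box d m) : Set (Site d)) x y).card := by
  -- adapted from `MeanCauchySchwarz.card_sq_le_card_mul_sum_card` (percolating ↦ armed points)
  set B := box d n with hB
  set Λ : Set (Site d) := (↑(box d m) : Set (Site d)) with hΛ
  set P := B.filter (fun x => ∃ y ∈ innerBoundary (zdGraph d) (box d m),
    ω ∈ openConnIn Λ x y) with hP
  set r : Site d → Site d → Prop := fun x y => ω ∈ openConnIn Λ x y with hr
  have hPB : ∀ x ∈ P, x ∈ B := fun x hx => (Finset.mem_filter.1 hx).1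
  have hParm : ∀ x ∈ P, ∃ y ∈ innerBoundary (zdGraph d) (box d m), ω ∈ openConnIn Λ x y :=
    fun x hx => (Finset.mem_filter.1 hx).2
  have hBΛ : ∀ x ∈ B, x ∈ Λ := fun x hx => Finset.mem_coe.2 (box_mono d hnm hx)
  have hrefl : ∀ x ∈ P, r x x := fun x hx =>
    ⟨hBΛ x (hPB x hx), hBΛ x (hPB x hx), SimpleGraph.Reachable.refl _⟩
  have hsymm : ∀ x ∈ P, ∀ y ∈ P, r x y → r y x := by
    rintro x - y - ⟨hx, hy, h⟩
    exact ⟨hy, hx, h.symm⟩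
  have htrans : ∀ x ∈ P, ∀ y ∈ P, ∀ z ∈ P, r x y → r y z → r x z := by
    rintro x - y - z - ⟨hx, _hy, h⟩ ⟨_hy', hz, h'⟩
    exact ⟨hx, hz, h.trans h'⟩
  have hA := MeanCauchySchwarz.card_sq_le_card_image_mul_sum P r hrefl hsymm htrans
  obtain ⟨f, hfP, hf⟩ := MeanCauchySchwarz.exists_transversal P r hsymm htrans
  have hmB : (P.image fun x => P.filter (r x)).card ≤ B.card :=
    Finset.card_image_le.trans (Finset.card_filter_le _ _)
  have hsum : ∑ x ∈ P, (P.filter (r x)).card ≤ ∑ x ∈ B, (B.filter (r x)).card := by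
    calc ∑ x ∈ P, (P.filter (r x)).card ≤ ∑ x ∈ P, (B.filter (r x)).card :=
          Finset.sum_le_sum fun x _ =>
            Finset.card_le_card (Finset.filter_subset_filter _ (Finset.filter_subset _ _))
      _ ≤ ∑ x ∈ B, (B.filter (r x)).card :=
          Finset.sum_le_sum_of_subset_of_nonneg (Finset.filter_subset _ _) fun _ _ _ => Nat.zero_le _
  refine hA.trans (Nat.mul_le_mul ?_ hsum)
  calc (P.image fun x => P.filter (r x)).card
      = (Finset.range (P.image fun x => P.filter (r x)).card).card := (Finset.card_range _).symm
    _ ≤ _ := Finset.card_le_card fun k hk => ?_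
  have hk' : k < (P.image fun x => P.filter (r x)).card := Finset.mem_range.1 hk
  exact Finset.mem_filter.2 ⟨Finset.mem_range.2 (lt_of_lt_of_le hk' hmB),
    fun i => f (Fin.castLE hk' i), fun i => hPB _ (hfP _), fun i => hParm _ (hfP _),
    fun i j hij => hf _ _ fun h => hij (Fin.castLE_injective hk' h)⟩

/-! ### Measurability of the armed event -/

/-- The armed event `{x ↔ ∂⁻B(m) inside B(m)}` is measurable (a finite union of the cylinder
events `openConnIn ↑(box d m) x y`, `DCT16.measurableSet_openConnIn`). -/
theorem measurableSet_armed (d m : ℕ) (x : Site d) :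
    MeasurableSet {ω : BondConfig (Site d) | ∃ y ∈ innerBoundary (zdGraph d) (box d m),
      ω ∈ openConnIn (↑(box d m) : Set (Site d)) x y} := by
  refine measurableSet_setOf.2 (Measurable.exists fun y => ?_)
  exact Measurable.and measurable_const (DCT16.measurableSet_openConnIn _ x y).mem

/-! ### From `V² ≤ N S` a.e. to `(E V)² ≤ E N · E S`, with point events of varying probability -/

/-- **The abstract mean inequality, inhomogeneous form.** For a probability measure `μ`, a finite
set `B`, events `Pev x` (`x ∈ B`), `R k` (`k ∈ Ks`) and `O x y`, all measurable: if almost surely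
`#{x ∈ B : Pev x}² ≤ #{k ∈ Ks : R k} · ∑_{x ∈ B} #{y ∈ B : O x y}`, then
`(∑_x μ(Pev x))² ≤ (∑_k μ(R k)) · ∑_{x,y ∈ B} μ(O x y)` (the variant of
`MeanCauchySchwarz.sq_mul_card_le_of_ae` without a common value of `μ(Pev x)`). -/
theorem sq_sum_le_of_ae {α ι κ : Type*} [MeasurableSpace α] (μ : Measure α)
    [IsProbabilityMeasure μ] (B : Finset ι) (Ks : Finset κ)
    {Pev : ι → Set α} {R : κ → Set α} {O : ι → ι → Set α}
    (hP : ∀ x, MeasurableSet (Pev x)) (hR : ∀ k, MeasurableSet (R k))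
    (hO : ∀ x y, MeasurableSet (O x y))
    (hpt : ∀ᵐ a ∂μ, ((B.filter fun x => a ∈ Pev x).card) ^ 2 ≤
        ((Ks.filter fun k => a ∈ R k).card) * ∑ x ∈ B, ((B.filter fun y => a ∈ O x y).card)) :
    (∑ x ∈ B, μ.real (Pev x)) ^ 2 ≤
      (∑ k ∈ Ks, μ.real (R k)) * ∑ x ∈ B, ∑ y ∈ B, μ.real (O x y) := by
  -- adapted from `MeanCauchySchwarz.sq_mul_card_le_of_ae` (`θ |B|` ↦ `∑_x μ(Pev x)`)
  -- the three random variables as sums of indicators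
  have hVint1 : ∀ x, Integrable (fun a => (Pev x).indicator (1 : α → ℝ) a) μ := fun x =>
    (integrable_const (1 : ℝ)).indicator (hP x)
  have hNint1 : ∀ k, Integrable (fun a => (R k).indicator (1 : α → ℝ) a) μ := fun k =>
    (integrable_const (1 : ℝ)).indicator (hR k)
  have hSint1 : ∀ x y, Integrable (fun a => (O x y).indicator (1 : α → ℝ) a) μ := fun x y =>
    (integrable_const (1 : ℝ)).indicator (hO x y)
  have hVi : Integrable (fun a => ∑ x ∈ B, (Pev x).indicator (1 : α → ℝ) a) μ :=
    integrable_finsetSum B fun x _ => hVint1 x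
  have hNi : Integrable (fun a => ∑ k ∈ Ks, (R k).indicator (1 : α → ℝ) a) μ :=
    integrable_finsetSum Ks fun k _ => hNint1 k
  have hSi : Integrable (fun a => ∑ x ∈ B, ∑ y ∈ B, (O x y).indicator (1 : α → ℝ) a) μ :=
    integrable_finsetSum B fun x _ => integrable_finsetSum B fun y _ => hSint1 x y
  -- their means
  have hVint : ∫ a, (∑ x ∈ B, (Pev x).indicator (1 : α → ℝ) a) ∂μ = ∑ x ∈ B, μ.real (Pev x) := by
    rw [integral_finsetSum B fun x _ => hVint1 x]
    exact Finset.sum_congr rfl fun x _ => integral_indicator_one (hP x)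
  have hNint : ∫ a, (∑ k ∈ Ks, (R k).indicator (1 : α → ℝ) a) ∂μ = ∑ k ∈ Ks, μ.real (R k) := by
    rw [integral_finsetSum Ks fun k _ => hNint1 k]
    exact Finset.sum_congr rfl fun k _ => integral_indicator_one (hR k)
  have hSint : ∫ a, (∑ x ∈ B, ∑ y ∈ B, (O x y).indicator (1 : α → ℝ) a) ∂μ =
      ∑ x ∈ B, ∑ y ∈ B, μ.real (O x y) := by
    rw [integral_finsetSum B fun x _ => integrable_finsetSum B fun y _ => hSint1 x y]
    refine Finset.sum_congr rfl fun x _ => ?_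
    rw [integral_finsetSum B fun y _ => hSint1 x y]
    exact Finset.sum_congr rfl fun y _ => integral_indicator_one (hO x y)
  rw [← hVint, ← hNint, ← hSint]
  have h01 : ∀ (s : Set α) (a : α), 0 ≤ s.indicator (1 : α → ℝ) a := fun s a =>
    Set.indicator_nonneg (fun _ _ => zero_le_one) a
  refine MeanCauchySchwarz.sq_integral_le_mul_integral hVi hNi hSi
    (ae_of_all _ fun a => Finset.sum_nonneg fun x _ => h01 _ a)
    (ae_of_all _ fun a => Finset.sum_nonneg fun k _ => h01 _ a)
    (ae_of_all _ fun a => Finset.sum_nonneg fun x _ => Finset.sum_nonneg fun y _ => h01 _ a) ?_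
  filter_upwards [hpt] with a ha
  simp only [Set.indicator_apply, Pi.one_apply, Finset.sum_boole]
  exact_mod_cast ha

end ArmCauchySchwarz

/-- **`stub_armCauchySchwarz`** (arm-mass Cauchy–Schwarz, line `Sketch_r2_ideator4` of crux
stmt-CriticalPhenomena-4447): for bond percolation on `ℤ³`, every `p` and `n`,
`A_p(n)² ≤ E_p[N_n] · E_p[S_n]`, where `A_p(n) = ∑_{x ∈ B(n)} P_p(x ↔ ∂⁻B(2n) inside B(2n))` is the
expected number of armed points of `B(n)`, `E_p[N_n]` the layer-cake sum over `k < |B(n)|` of the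
probabilities of the `k`-th representative event in `B(2n)` and `E_p[S_n]` the expected number of
ordered pairs of `B(n)` joined inside `B(2n)` (pointwise `V² ≤ N S` for every `ω`, then the
integrated Cauchy–Schwarz `MeanCauchySchwarz.sq_integral_le_mul_integral`). -/
theorem stub_armCauchySchwarz :
    ∀ (p : unitInterval) (n : ℕ),
      (∑ x ∈ box 3 n, (bondPercolation (zdGraph 3) p).real
          {ω | ∃ y ∈ innerBoundary (zdGraph 3) (box 3 (2 * n)),
            ω ∈ openConnIn (↑(box 3 (2 * n)) : Set (Site 3)) x y}) ^ 2 ≤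
        (∑ k ∈ Finset.range (box 3 n).card, (bondPercolation (zdGraph 3) p).real
          {ω | ∃ x : Fin (k + 1) → Site 3, (∀ i, x i ∈ box 3 n) ∧
            (∀ i, ∃ y ∈ innerBoundary (zdGraph 3) (box 3 (2 * n)),
              ω ∈ openConnIn (↑(box 3 (2 * n)) : Set (Site 3)) (x i) y) ∧
            ∀ i j, i ≠ j → ω ∉ openConnIn (↑(box 3 (2 * n)) : Set (Site 3)) (x i) (x j)}) *
        ∑ x ∈ box 3 n, ∑ y ∈ box 3 n,
          (bondPercolation (zdGraph 3) p).real (openConnIn (↑(box 3 (2 * n)) : Set (Site 3)) x y) := by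
  intro p n
  refine ArmCauchySchwarz.sq_sum_le_of_ae (bondPercolation (zdGraph 3) p) (box 3 n)
    (Finset.range (box 3 n).card)
    (Pev := fun x => {ω | ∃ y ∈ innerBoundary (zdGraph 3) (box 3 (2 * n)),
      ω ∈ openConnIn (↑(box 3 (2 * n)) : Set (Site 3)) x y})
    (fun x => ArmCauchySchwarz.measurableSet_armed 3 (2 * n) x)
    (fun k => MeanCauchySchwarz.measurableSet_spanningFamily 3 n (2 * n) k)
    (fun x y => DCT16.measurableSet_openConnIn _ x y) (ae_of_all _ fun ω => ?_)
  -- the two sides differ only in the `Decidable` instances of the filters (`convert` closes them)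
  -- and in the spelling `ω ∈ {ω | E ω}` versus `E ω` of the point and representative events
  convert ArmCauchySchwarz.card_sq_le 3 (n := n) (m := 2 * n) (by omega) ω <;> exact Iff.rfl

end Summit.CriticalPhenomena.PercolationContinuityZ3.FreeBoxPowerSavingLine
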